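import Mathlib
import Summits.MatrixMultiplication.MatrixMultiplication.Theses.FourierTwoFamiliesModP
import Literature.Computability.AlgebraicComplexity.SimultaneousDoubleProduct

/-!
# The crux is a ladder: `PrimeTwoFamilies → CyclicLadderConjecture` (line `Sketch`, converse direction)

Crux `PrimeTwoFamilies` (stmt-MatrixMultiplication-14308, route `FourierTwoFamiliesModP`): CKSU 2005
Conj. 4.7 with prime cyclic hosts.  Line `Sketch` (Cruxes/PrimeTwoFamilies/Lines/Sketch.lean) derives the
crux from the CYCLIC LADDER CONJECTURE — for every `ε > 0` and arbitrarily large `m`, an ordered escape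
ladder in `ℤ/m` ((i) every class `X c ⊕ Y c` direct; (ii) for classes `p < q` every lower cross
difference `y' - x'`, `x' ∈ X p`, `y' ∈ Y q`, differs from every diagonal difference `y - x`, `x ∈ X c`,
`y ∈ Y c`) with `r ≥ m^{1/2-ε}` classes of co-volume `|X c||Y c| ≥ m^{1-ε}` — by the constant-sum lift and
the carry-free transfer (registered stubs `stub_lift`, `stub_words`, `stub_bookkeeping`, all landed, and
the open stub `stub_cyclicLadder`).

This file is the CONVERSE: an SDPP witness of the crux in `ℤ/p` is itself a ladder in `ℤ/p` for ANY
order of its indices (clause (X) at `(i, j, k) = (p, c, q)` is exactly (ii), in both directions), with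
`r = n ≥ p^{1/(2+δ)}` classes of co-volume `≥ n^{2-δ} ≥ p^{(2-δ)/(2+δ)}`; taking `δ = min ε 1` gives the
ladder conjecture's slice `ε`.  Hence the open stub of the line is EQUIVALENT to the crux — the line
loses nothing and gains the one-directional, host-free form — and, read negatively, every obstruction to
ladders near `(θ, γ) = (1/2, 1)` is an obstruction to the crux.
-/

-- single-conjunct summit: the mandated namespace repeats `MatrixMultiplication` (summit = sub-problem).
set_option linter.dupNamespace false

namespace Summit.MatrixMultiplication.MatrixMultiplication.Theorems.PrimeTwoFamilies.LadderLift

open Finset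
open Summit.MatrixMultiplication.MatrixMultiplication.Theses
open Literature.Computability.AlgebraicComplexity

/-- Exponent bookkeeping of the converse: for `0 < δ ≤ ε`, `δ ≤ 1`, a prime-size level `p ≥ 1` and
`n ≥ 1` with `p ≤ n^{2+δ}`, one has `p^{1/2-ε} ≤ n` and `p^{1-ε} ≤ n^{2-δ}`. -/
theorem ladder_exponents {ε δ : ℝ} (hδ : 0 < δ) (hδε : δ ≤ ε) (hδ1 : δ ≤ 1) {p n : ℕ}
    (hp : 1 ≤ p) (hn : 1 ≤ n) (hpn : (p : ℝ) ≤ (n : ℝ) ^ (2 + δ)) :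
    (p : ℝ) ^ (1 / 2 - ε) ≤ (n : ℝ) ∧ (p : ℝ) ^ (1 - ε) ≤ (n : ℝ) ^ (2 - δ) := by
  have hp0 : (0 : ℝ) ≤ p := Nat.cast_nonneg p
  have hp1 : (1 : ℝ) ≤ p := by exact_mod_cast hp
  have hn0 : (0 : ℝ) ≤ n := Nat.cast_nonneg n
  have hn1 : (1 : ℝ) ≤ n := by exact_mod_cast hn
  have h2δ : (2 + δ) ≠ 0 := by linarith
  -- `p^{1/(2+δ)} ≤ n`
  have hroot : (p : ℝ) ^ (1 / (2 + δ)) ≤ n := by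
    have h1 : (p : ℝ) ^ (1 / (2 + δ)) ≤ ((n : ℝ) ^ (2 + δ)) ^ (1 / (2 + δ)) :=
      Real.rpow_le_rpow hp0 hpn (by positivity)
    rw [one_div, Real.rpow_rpow_inv hn0 h2δ] at h1
    rwa [one_div]
  refine ⟨?_, ?_⟩
  · -- `p^{1/2-ε} ≤ p^{1/(2+δ)} ≤ n` when `1/2 - ε ≤ 1/(2+δ)`, and `≤ 1 ≤ n` otherwise
    by_cases hε : 1 / 2 - ε ≤ 0
    · exact (Real.rpow_le_one_of_one_le_of_nonpos hp1 hε).trans hn1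
    · push Not at hε
      have hexp : 1 / 2 - ε ≤ 1 / (2 + δ) := by
        rw [div_eq_mul_inv, div_eq_mul_inv, one_mul, one_mul]
        rw [show (2 : ℝ)⁻¹ - ε = ((1 - 2 * ε) / 2) by ring]
        rw [div_le_iff₀ (by norm_num : (0 : ℝ) < 2)]
        rw [show (2 + δ)⁻¹ * 2 = 2 / (2 + δ) by ring]
        rw [le_div_iff₀ (by linarith : (0 : ℝ) < 2 + δ)]
        nlinarith
      exact (Real.rpow_le_rpow_of_exponent_le hp1 hexp).trans hroot
  · -- `p^{1-ε} ≤ p^{(2-δ)/(2+δ)} = (p^{1/(2+δ)})^{2-δ} ≤ n^{2-δ}`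
    have hexp : 1 - ε ≤ (1 / (2 + δ)) * (2 - δ) := by
      rw [one_div, inv_mul_eq_div, le_div_iff₀ (by linarith : (0 : ℝ) < 2 + δ)]
      nlinarith
    calc (p : ℝ) ^ (1 - ε) ≤ (p : ℝ) ^ ((1 / (2 + δ)) * (2 - δ)) :=
          Real.rpow_le_rpow_of_exponent_le hp1 hexp
      _ = ((p : ℝ) ^ (1 / (2 + δ))) ^ (2 - δ) := Real.rpow_mul hp0 _ _
      _ ≤ (n : ℝ) ^ (2 - δ) := Real.rpow_le_rpow (by positivity) hroot (by linarith)

/-- **The crux is a ladder** (converse of line `Sketch`): `PrimeTwoFamilies` implies the cyclic ladder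
conjecture, stated with the two ladder clauses inlined — for every `ε > 0` and `m₀` there are `m ≥ m₀`
(here a prime), `r` classes `(X c, Y c)` in `ZMod m` with (i) every class direct, (ii) lower cross
differences (`p < q`) avoiding all diagonal differences, `m^{1/2-ε} ≤ r`, and co-volumes
`m^{1-ε} ≤ |X c| |Y c|`.  Proof: an SDPP witness `(A i, B i)_{i<n}` in `ℤ/p` of the slice
`δ = min ε 1` is such a ladder with `m = p`, `r = n` (clause (X) at `(i,j,k) = (p,c,q)` gives (ii)),
and `p ≤ n^{2+δ}`, `n^{2-δ} ≤ |A i||B i| ≤ p` give the exponents (`ladder_exponents`). -/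
theorem cyclicLadder_of_primeTwoFamilies (hT : FourierTwoFamiliesModP.PrimeTwoFamilies) :
    ∀ ε : ℝ, 0 < ε → ∀ m₀ : ℕ, ∃ m ≥ m₀, ∃ r : ℕ, ∃ X Y : Fin r → Finset (ZMod m),
      ((∀ c : Fin r, ∀ x ∈ X c, ∀ x' ∈ X c, ∀ y ∈ Y c, ∀ y' ∈ Y c,
          (x - x') + (y - y') = 0 → x = x' ∧ y = y') ∧
        (∀ c p q : Fin r, p < q → ∀ x ∈ X c, ∀ y ∈ Y c, ∀ x' ∈ X p, ∀ y' ∈ Y q,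
          y - x ≠ y' - x')) ∧
      (m : ℝ) ^ (1 / 2 - ε) ≤ (r : ℝ) ∧
      ∀ c : Fin r, (m : ℝ) ^ (1 - ε) ≤ (((X c).card * (Y c).card : ℕ) : ℝ) := by
  intro ε hε m₀
  set δ : ℝ := min ε 1 with hδdef
  have hδ : 0 < δ := lt_min hε one_pos
  have hδε : δ ≤ ε := min_le_left _ _
  have hδ1 : δ ≤ 1 := min_le_right _ _
  obtain ⟨n, hn, p, hp, A, B, hW, hX, hpn, hAB⟩ := hT δ hδ (m₀ + 2)
  haveI : Fact p.Prime := ⟨hp⟩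
  have hn1 : 1 ≤ n := by omega
  have hn1' : (1 : ℝ) ≤ n := by exact_mod_cast hn1
  -- `m₀ ≤ p`: `m₀ + 2 ≤ n ≤ n^{2-δ} ≤ |A i||B i| ≤ p`
  have i₀ : Fin n := ⟨0, by omega⟩
  have hABp : (A i₀).card * (B i₀).card ≤ p := by
    have := card_mul_card_le_of_dpp (H := ZMod p) (hW i₀)
    rwa [ZMod.card] at this
  have hm₀ : m₀ ≤ p := by
    have h1 : (n : ℝ) ≤ (n : ℝ) ^ (2 - δ) := by
      calc (n : ℝ) = (n : ℝ) ^ (1 : ℝ) := (Real.rpow_one _).symm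
        _ ≤ (n : ℝ) ^ (2 - δ) := Real.rpow_le_rpow_of_exponent_le hn1' (by linarith)
    have h2 : (n : ℝ) ≤ (p : ℝ) := (h1.trans (hAB i₀)).trans (by exact_mod_cast hABp)
    have h3 : n ≤ p := by exact_mod_cast h2
    omega
  obtain ⟨hr, hcov⟩ := ladder_exponents hδ hδε hδ1 hp.one_lt.le hn1 hpn
  refine ⟨p, hm₀, n, A, B, ⟨hW, ?_⟩, hr, fun c => hcov.trans (hAB c)⟩
  -- (ii) from clause (X) at `(i, j, k) = (p', c, q)`
  intro c p' q hpq x hx y hy x' hx' y' hy' heq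
  have h0 : (x' - x) + (y - y') = 0 := by
    rw [show (x' - x) + (y - y') = (y - x) - (y' - x') by abel, heq, sub_self]
  exact (ne_of_lt hpq) (hX p' c q x' hx' x hx y hy y' hy' h0)

end Summit.MatrixMultiplication.MatrixMultiplication.Theorems.PrimeTwoFamilies.LadderLift
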